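import Literature.Computability.Complexity.NPSubsetNTIME
import Literature.Computability.Complexity.TruncMapMachine

/-!
# Route CompactnessLift · crux `CompactnessPrinciple` (stmt-QuantumAdvantage-15270), line
# `universal-clock-padding`: the truncate-then-run pre-processor `M̂` (stub `stub_truncRun`)

For `L ∈ BPP` presented by a decider `M'` of the inner language (time `a · n ^ k + a`) and the coin
polynomial `p`, the clocked pre-processor `M̂` takes a padded pair `⟨x, z⟩` (`z` a long coin
string), TRUNCATES the coins to the first `p |x|` of them and runs `M'` on the short word
`⟨x, z ↾ p |x|⟩`. This file proves that such an `M̂` exists with running time `A(|x|) + |z|`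
(a polynomial in `|x|` plus a LINEAR overhead in the discarded coins) and with output exactly
`M'`'s output on the truncated pair.

The proof is the pattern of `exists_machine_pair_ones` / the running-time half of
`NP_subset_NTIME_two_pow` (`Literature/Computability/Complexity/NPSubsetNTIME.lean`):
the polynomial clock `x ↦ ⟨x, 1^{p |x|}⟩` is in `FP` (`fanoutFn_mem_FP`, `polyFn_mem_FP`), the
tree's truncating wrapper `truncMapAux` (`TruncMapMachine.lean`,
`outputsWithin_truncMapAux_boolPair`) turns it into `⟨x, z⟩ ↦ ⟨x, z ↾ p |x|⟩` within
`poly(|x|) + |z| / 2` steps, and sequential composition with `M'`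
(`Turing.TM2ComputableAux.comp_outputsWithin`, additive running time) finishes.

## References

* S. Arora, B. Barak, *Computational Complexity: A Modern Approach*, CUP 2009, §1.3 (composition
  of machines), Thm. 1.9 / §1.4.1 (clocked simulation).
-/

-- the Summit.QuantumAdvantage.QuantumAdvantage.… namespace repeats summit = sub-problem (D-0017 layout)
set_option linter.dupNamespace false

namespace Summit.QuantumAdvantage.QuantumAdvantage.Theorems

open Literature.Computability.Complexity Polynomial
open _root_.Computability Turing Brick Plumb

/-- **The truncate-then-run pre-processor.** For a machine `M'` with output function `out` and
running time `a · |v| ^ k + a`, and a polynomial `p`, there is a machine `M̂` and a polynomial `A`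
such that on every pair `⟨x, z⟩` the machine `M̂` outputs `out ⟨x, z ↾ p |x|⟩` within
`A |x| + |z|` steps: `M̂ := (truncMapAux N).comp M'` for a polynomial-time machine `N` of the
clock `x ↦ ⟨x, 1^{p |x|}⟩`; the wrapper costs `poly(|x|) + |z| / 2` steps
(`outputsWithin_truncMapAux_boolPair`) and `M'` on the short word `⟨x, z ↾ p |x|⟩` (length
`≤ 2 |x| + 2 + p |x|`) costs `a · (2 |x| + 2 + p |x|) ^ k + a` more. [Arora–Barak 2009, §1.3,
§1.4.1] -/
theorem stub_truncRun (M' : Turing.TM2ComputableAux Bool Bool) (out : List Bool → List Bool)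
    (p : Polynomial ℕ) (a k : ℕ)
    (hM' : ∀ v : List Bool, M'.OutputsWithin v (out v) (a * v.length ^ k + a)) :
    ∃ (Mhat : Turing.TM2ComputableAux Bool Bool) (A : Polynomial ℕ), ∀ x z : List Bool,
      Mhat.OutputsWithin (boolPair x z) (out (boolPair x (z.take (p.eval x.length))))
        (A.eval x.length + z.length) := by
  -- (1) the polynomial clock `x ↦ ⟨x, 1^{p |x|}⟩`
  have hclk : fanoutFn id (polyFn p) ∈ FP :=
    fanoutFn_mem_FP OracleCompose.id_mem_FP (polyFn_mem_FP _)
  obtain ⟨q, N, hN⟩ := hclk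
  have hN' : ∀ x : List Bool,
      N.OutputsWithin x (boolPair x (ones (p.eval x.length))) (q.eval x.length) := by
    intro x
    have := hN x
    simpa [fanoutFn_apply] using this
  refine ⟨(truncMapAux N).comp M', q + 5 * X + 2 * p + 11 + (C a * (2 * X + 2 + p) ^ k + C a),
    fun x z => ?_⟩
  -- (2) the truncating wrapper on the well-formed pair `⟨x, z⟩`
  have h₁ := outputsWithin_truncMapAux_boolPair N (y := z) (hN' x)
  simp only [List.length_replicate] at h₁
  set z' := z.take (p.eval x.length) with hz'
  have hlen' : z'.length ≤ p.eval x.length := List.length_take_le _ _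
  -- (3) `M'` on the short word
  have h₂ : M'.OutputsWithin (boolPair x z') (out (boolPair x z'))
      (a * (2 * x.length + 2 + p.eval x.length) ^ k + a) := by
    refine (hM' (boolPair x z')).mono ?_
    simp only [length_boolPair]
    have : 2 * x.length + 2 + z'.length ≤ 2 * x.length + 2 + p.eval x.length := by omega
    exact Nat.add_le_add_right (Nat.mul_le_mul_left a (Nat.pow_le_pow_left this k)) a
  -- (4) compose, (5) dominate the total running time by `A |x| + |z|`
  have h := Turing.TM2ComputableAux.comp_outputsWithin _ _ h₁ h₂
  refine h.mono ?_
  simp only [eval_add, eval_mul, eval_ofNat, eval_X, eval_pow, eval_C]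
  have hz2 : z.length / 2 ≤ z.length := Nat.div_le_self _ _
  omega

end Summit.QuantumAdvantage.QuantumAdvantage.Theorems
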